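import Literature.AlgebraicGeometry.Modules.BoxTensor
import Literature.AlgebraicGeometry.Modules.TensorSectionsAffine
import Literature.AlgebraicGeometry.Modules.PullbackSectionsBaseChange
import Literature.AlgebraicGeometry.Modules.PullbackQuasicoherent
import Mathlib.LinearAlgebra.TensorProduct.Tower
import HarnessLib

/-!
# Sections of an external tensor product over an affine open of a fibre product:
# `Γ(U ×_{U_S} V, E ⊠ F) ≃ Γ(U, E) ⊗_K Γ(V, F)` (`K = Γ(U_S, 𝒪_S)`, e.g. a base field)

Layer `Literature/AlgebraicGeometry/Modules` (one construction, 0 named facts, no instance, no notation). For a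
CARTESIAN square `p ≫ i_X = q ≫ i_Y` (`Z = X ×_S Y`, projections `p : Z → X`, `q : Z → Y`), affine opens `U_S ⊆ S`,
`U ⊆ i_X⁻¹U_S`, `V ⊆ i_Y⁻¹U_S`, the affine open `W = p⁻¹U ∩ q⁻¹V = U ×_{U_S} V` of `Z`, AFFINE-LOCALIZING
(= quasi-coherent) modules `E` on `X`, `F` on `Y`, and a commutative ring `K` identified with `Γ(U_S, 𝒪_S)`
(`φ : K ≃+* Γ(U_S)`; for `S = Spec k`, `U_S = ⊤`, `K = k` take `φ = (ΓSpecIso k)⁻¹`), the `K`-linear comparison map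
`boxTensorSectionsHom : Γ(U, E) ⊗_K Γ(V, F) → Γ(W, E ⊠ F)`, `m ⊗ n ↦ η_p(m)|_W ⊗ η_q(n)|_W` (`boxTensor p q E F =
p^*E ⊗ q^*F` of `Modules/BoxTensor`; `η(·)|` = `unitSectionLE`; `⊗` of sections = `tmulSection`) is BIJECTIVE
(`boxTensorSectionsHom_bijective`), for any `K`-module structures on the three section modules whose scalars act through
`i_X♯ ∘ φ`, `i_Y♯ ∘ φ`, `(p ≫ i_X)♯ ∘ φ` (hypotheses `hKE`, `hKF`, `hKW`, the idiom of `Modules/PullbackSectionsBaseChange`);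
packaged as **`boxTensorSectionsEquiv : Γ(W, E ⊠ F) ≃ₗ[K] Γ(U, E) ⊗_K Γ(V, F)`** (`boxTensorSectionsEquiv_symm_tmul`), NATURAL
under restriction to smaller affine opens `U' ⊆ U`, `V' ⊆ V`, `W' = p⁻¹U' ∩ q⁻¹V'` (`boxTensorSectionsHom_natural`,
**`boxTensorSectionsEquiv_natural`**: restriction on `Z` corresponds to `ρ_E ⊗ ρ_F`).

This is the affine computation behind the Künneth formula (Görtz–Wedhorn I): for `U = Spec A`, `V = Spec B`,
`U_S = Spec R`, "Set `Z = Spec(A ⊗_R B)` […] Then `(Z, p, q)` is a fiber product of `X` and `Y` over `S`" (Prop. 4.17),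
"`f^*(M~) ≅ (B ⊗_A M)~`" (Prop. 7.24 (2)) and "`Γ(U, 𝓕 ⊗_{𝒪_X} 𝓖) = Γ(U, 𝓕) ⊗_{Γ(U, 𝒪_X)} Γ(U, 𝓖)`" for `U` affine
(Cor. 7.19 (4), (7.10.2); The Stacks Project, Tag 01I8 (1)), whence `Γ(W, M~ ⊠ N~) = ((A ⊗_R B) ⊗_A M) ⊗_{A ⊗_R B}
((A ⊗_R B) ⊗_B N) = M ⊗_R N`. Proof of bijectivity: the chain `M ⊗_K N = M ⊗_R N ≅ M ⊗_A (A ⊗_R N) ≅ M ⊗_A Γ(W, q^*F)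
≅ Γ(W, q^*F) ⊗_C (C ⊗_A M) ≅ Γ(W, q^*F) ⊗_C Γ(W, p^*E) ≅ Γ(W, p^*E ⊗ q^*F)` (`C = Γ(W)`) IS the comparison map; it is
assembled from the tree's `exists_linearEquiv_tensor_sections_pullback` (for the flipped square, and for the degenerate
square `Z = Z ×_X X`, which gives the chart formula `C ⊗_A Γ(U, E) ≅ Γ(W, p^*E)`), `tensorUnitHom_app_bijective_of_isAffineOpen`
(`Modules/TensorSectionsAffine`) and Mathlib's `AlgebraTensorModule.cancelBaseChange`, `equivOfCompatibleSMul`,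
`TensorProduct.comm`, `LinearEquiv.lTensor`, `IsPullback.of_id_snd`, `LinearEquiv.ofBijective` (Mathlib searched, pin v4.32).
Library only (cell `pub-hodge-ring2`, count-neutral); proves nothing about any crux, route or conjecture.
-- NOT HERE: the assembly over finite affine covers, `Č•(p⁻¹𝔘 ∩ q⁻¹𝔙, E ⊠ F) ≅ Tot(Č•(𝔘, E) ⊗_K Č•(𝔙, F))` (Tag 0BEC).

## References

* U. Görtz, T. Wedhorn, *Algebraic Geometry I: Schemes*, 2nd ed. (2020): Prop. 4.17, Cor. 4.19, Cor. 7.19 (4) with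
  (7.10.2), Prop. 7.24 (2), Rem. 7.25. [GortzWedhorn2020]
* The Stacks Project, Tag 01I8 (1), Tag 0BEC (Künneth formula). [StacksProject]
-/

noncomputable section

set_option backward.isDefEq.respectTransparency false -- `Scheme.Modules` is not reducible (as in Mathlib)

open CategoryTheory CategoryTheory.Limits AlgebraicGeometry TopologicalSpace Opposite TensorProduct

universe u v

namespace Literature.AlgebraicGeometry.Modules

variable {X Y Z S : Scheme.{u}} {p : Z ⟶ X} {q : Z ⟶ Y} {iX : X ⟶ S} {iY : Y ⟶ S}
  {US : S.Opens} {U U' : X.Opens} {V V' : Y.Opens} {W W' : Z.Opens} {E : X.Modules} {F : Y.Modules}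
  {K : Type v} [CommRing K]

/-- `W ≤ (p ≫ i_X)⁻¹ U_S` for `W = p⁻¹U ∩ q⁻¹V` and `U ⊆ i_X⁻¹U_S`. [cite: GortzWedhorn2020, Cor. 4.19] -/
theorem le_preimage_comp_of_eq_inf (hUle : U ≤ iX ⁻¹ᵁ US) (hW : W = p ⁻¹ᵁ U ⊓ q ⁻¹ᵁ V) :
    W ≤ (p ≫ iX) ⁻¹ᵁ US :=
  (le_preimage_left_of_eq_inf hW).trans (Scheme.Hom.preimage_mono p hUle)

/-- `p♯(i_X♯ r)|_W = (p ≫ i_X)♯(r)|_W`. [cite: GortzWedhorn2020, Cor. 4.19] -/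
theorem appLE_appLE_fst_apply (hUle : U ≤ iX ⁻¹ᵁ US) (hW : W = p ⁻¹ᵁ U ⊓ q ⁻¹ᵁ V) (r : Γ(S, US)) :
    p.appLE U W (le_preimage_left_of_eq_inf hW) (iX.appLE US U hUle r) =
      (p ≫ iX).appLE US W (le_preimage_comp_of_eq_inf hUle hW) r := by
  have h := congrArg (fun ψ : Γ(S, US) ⟶ Γ(Z, W) => ψ r)
    (Scheme.Hom.appLE_comp_appLE p iX US U W hUle (le_preimage_left_of_eq_inf hW))
  simpa only [CommRingCat.comp_apply] using h

/-- `q♯(i_Y♯ r)|_W = (p ≫ i_X)♯(r)|_W` when `p ≫ i_X = q ≫ i_Y`. [cite: GortzWedhorn2020, Cor. 4.19] -/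
theorem appLE_appLE_snd_apply (w : p ≫ iX = q ≫ iY) (hUle : U ≤ iX ⁻¹ᵁ US) (hVle : V ≤ iY ⁻¹ᵁ US)
    (hW : W = p ⁻¹ᵁ U ⊓ q ⁻¹ᵁ V) (r : Γ(S, US)) :
    q.appLE V W (le_preimage_right_of_eq_inf hW) (iY.appLE US V hVle r) =
      (p ≫ iX).appLE US W (le_preimage_comp_of_eq_inf hUle hW) r := by
  have h := congrArg (fun ψ : Γ(S, US) ⟶ Γ(Z, W) => ψ r)
    (Scheme.Hom.appLE_comp_appLE q iY US V W hVle (le_preimage_right_of_eq_inf hW))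
  simp only [CommRingCat.comp_apply] at h
  simp only [h, w]

/-- `(𝟙 X)♯ : Γ(U, 𝒪_X) → Γ(U, 𝒪_X)` (over `U ⊆ (𝟙 X)⁻¹U = U`) is the identity. [folklore] -/
private theorem id_appLE_apply (h : U ≤ (𝟙 X) ⁻¹ᵁ U) (r : Γ(X, U)) : Scheme.Hom.appLE (𝟙 X) U U h r = r := by
  have e : Scheme.Hom.appLE (𝟙 X) U U h = 𝟙 _ := (Scheme.Hom.appLE_eq_app _).trans (Scheme.Hom.id_app U)
  exact e ▸ rfl

/-- **The comparison map `Γ(U, E) ⊗_K Γ(V, F) → Γ(W, E ⊠ F)`, `m ⊗ n ↦ η_p(m)|_W ⊗ η_q(n)|_W`** for a commutative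
square `p ≫ i_X = q ≫ i_Y`, `W = p⁻¹U ∩ q⁻¹V`, and `K`-module structures on `Γ(U, E)`, `Γ(V, F)`, `Γ(W, E ⊠ F)` acting
through `i_X♯ ∘ φ`, `i_Y♯ ∘ φ`, `(p ≫ i_X)♯ ∘ φ` (`K`-bilinear by `η(r·m) = p♯(r)·η(m)`, `unitSectionLE_smul`, and
`tmulSection_smul_left/right`). [cite: GortzWedhorn2020, Cor. 7.19 (4) and Prop. 7.24 (2)] [cite: StacksProject, Tag 01I8] -/
def boxTensorSectionsHom (w : p ≫ iX = q ≫ iY) (hUle : U ≤ iX ⁻¹ᵁ US) (hVle : V ≤ iY ⁻¹ᵁ US)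
    (hW : W = p ⁻¹ᵁ U ⊓ q ⁻¹ᵁ V) (φ : K ≃+* Γ(S, US))
    [Module K Γ(E, U)] (hKE : ∀ (c : K) (m : Γ(E, U)), c • m = iX.appLE US U hUle (φ c) • m)
    [Module K Γ(F, V)] (hKF : ∀ (c : K) (n : Γ(F, V)), c • n = iY.appLE US V hVle (φ c) • n)
    [Module K Γ(boxTensor p q E F, W)] (hKW : ∀ (c : K) (s : Γ(boxTensor p q E F, W)),
      c • s = (p ≫ iX).appLE US W (le_preimage_comp_of_eq_inf hUle hW) (φ c) • s) :
    Γ(E, U) ⊗[K] Γ(F, V) →ₗ[K] Γ(boxTensor p q E F, W) :=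
  TensorProduct.lift
    (LinearMap.mk₂ K
      (fun (m : Γ(E, U)) (n : Γ(F, V)) =>
        (tmulSection ((Scheme.Modules.pullback p).obj E) ((Scheme.Modules.pullback q).obj F) W
          (unitSectionLE p E (le_preimage_left_of_eq_inf hW) m)
          (unitSectionLE q F (le_preimage_right_of_eq_inf hW) n) : Γ(boxTensor p q E F, W)))
      (fun m₁ m₂ n => by rw [unitSectionLE_add, tmulSection_add_left])
      (fun c m n => by
        rw [hKE, unitSectionLE_smul, tmulSection_smul_left, appLE_appLE_fst_apply hUle hW, ← hKW])
      (fun m n₁ n₂ => by rw [unitSectionLE_add, tmulSection_add_right])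
      (fun c m n => by
        rw [hKF, unitSectionLE_smul, tmulSection_smul_right, appLE_appLE_snd_apply w hUle hVle hW, ← hKW]))

section

variable (H : IsPullback p q iX iY) (w : p ≫ iX = q ≫ iY) (hUS : IsAffineOpen US) (hU : IsAffineOpen U)
  (hV : IsAffineOpen V) (hU' : IsAffineOpen U') (hV' : IsAffineOpen V') (hUle : U ≤ iX ⁻¹ᵁ US)
  (hVle : V ≤ iY ⁻¹ᵁ US) (hW : W = p ⁻¹ᵁ U ⊓ q ⁻¹ᵁ V) (hU'le : U' ≤ iX ⁻¹ᵁ US) (hV'le : V' ≤ iY ⁻¹ᵁ US)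
  (hW' : W' = p ⁻¹ᵁ U' ⊓ q ⁻¹ᵁ V') (hE : IsAffineLocalizing E) (hF : IsAffineLocalizing F) (φ : K ≃+* Γ(S, US))
  [Module K Γ(E, U)] (hKE : ∀ (c : K) (m : Γ(E, U)), c • m = iX.appLE US U hUle (φ c) • m)
  [Module K Γ(F, V)] (hKF : ∀ (c : K) (n : Γ(F, V)), c • n = iY.appLE US V hVle (φ c) • n)
  [Module K Γ(boxTensor p q E F, W)] (hKW : ∀ (c : K) (s : Γ(boxTensor p q E F, W)),
    c • s = (p ≫ iX).appLE US W (le_preimage_comp_of_eq_inf hUle hW) (φ c) • s)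
  [Module K Γ(E, U')] (hKE' : ∀ (c : K) (m : Γ(E, U')), c • m = iX.appLE US U' hU'le (φ c) • m)
  [Module K Γ(F, V')] (hKF' : ∀ (c : K) (n : Γ(F, V')), c • n = iY.appLE US V' hV'le (φ c) • n)
  [Module K Γ(boxTensor p q E F, W')] (hKW' : ∀ (c : K) (s : Γ(boxTensor p q E F, W')),
    c • s = (p ≫ iX).appLE US W' (le_preimage_comp_of_eq_inf hU'le hW') (φ c) • s)

/-- `boxTensorSectionsHom (m ⊗ n) = η_p(m)|_W ⊗ η_q(n)|_W`. [cite: GortzWedhorn2020, Cor. 7.19 (4) and Prop. 7.24 (2)] -/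
@[simp]
theorem boxTensorSectionsHom_tmul (m : Γ(E, U)) (n : Γ(F, V)) :
    boxTensorSectionsHom w hUle hVle hW φ hKE hKF hKW (m ⊗ₜ n) =
      tmulSection ((Scheme.Modules.pullback p).obj E) ((Scheme.Modules.pullback q).obj F) W
        (unitSectionLE p E (le_preimage_left_of_eq_inf hW) m)
        (unitSectionLE q F (le_preimage_right_of_eq_inf hW) n) :=
  rfl

include hUS hU hV hE hF in
/-- **`Γ(U, E) ⊗_K Γ(V, F) → Γ(W, E ⊠ F)` is bijective** for a cartesian square over affine opens `U_S`, `U`, `V`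
(`W = U ×_{U_S} V`) and affine-localizing `E`, `F`: it is the composite of the bijections `M ⊗_K N = M ⊗_R N ≅
M ⊗_A (A ⊗_R N) ≅ M ⊗_A Q ≅ Q ⊗_C (C ⊗_A M) ≅ Q ⊗_C P ≅ Γ(W, p^*E ⊗ q^*F)` (`R = Γ(U_S)`, `A = Γ(U)`, `C = Γ(W)`,
`P = Γ(W, p^*E)`, `Q = Γ(W, q^*F)`). [cite: GortzWedhorn2020, Cor. 7.19 (4) and Prop. 7.24 (2)] [cite: StacksProject, Tag 01I8] -/
theorem boxTensorSectionsHom_bijective :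
    Function.Bijective (boxTensorSectionsHom H.w hUle hVle hW φ hKE hKF hKW) := by
  have hWU := le_preimage_left_of_eq_inf hW
  have hWaff : IsAffineOpen W := isAffineOpen_of_isPullback_of_eq_inf H hUS hV hU hVle hUle hW
  let PE := (Scheme.Modules.pullback p).obj E
  let QF := (Scheme.Modules.pullback q).obj F
  let ψA : Γ(S, US) →+* Γ(X, U) := (iX.appLE US U hUle).hom
  let ψB : Γ(S, US) →+* Γ(Y, V) := (iY.appLE US V hVle).hom
  let πp : Γ(X, U) →+* Γ(Z, W) := (p.appLE U W hWU).hom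
  letI : Algebra Γ(S, US) Γ(X, U) := ψA.toAlgebra
  letI : Algebra K Γ(X, U) := (ψA.comp φ.toRingHom).toAlgebra
  letI : Algebra Γ(X, U) Γ(Z, W) := πp.toAlgebra
  letI : Module Γ(S, US) Γ(E, U) := Module.compHom _ ψA
  letI : Module Γ(S, US) Γ(F, V) := Module.compHom _ ψB
  letI : Module Γ(X, U) Γ(QF, W) := Module.compHom _ πp
  haveI : IsScalarTower Γ(S, US) Γ(X, U) Γ(E, U) := IsScalarTower.of_algebraMap_smul fun r m => rfl
  haveI : IsScalarTower K Γ(X, U) Γ(E, U) := IsScalarTower.of_algebraMap_smul fun c m => (hKE c m).symm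
  haveI : IsScalarTower Γ(X, U) Γ(Z, W) Γ(QF, W) := IsScalarTower.of_algebraMap_smul fun a s => rfl
  haveI : SMulCommClass Γ(S, US) K Γ(E, U) :=
    ⟨fun r c m => by rw [hKE, hKE]; change ψA r • _ = _ • ψA r • m; exact smul_comm _ _ _⟩
  haveI : CompatibleSMul Γ(S, US) K Γ(E, U) Γ(F, V) :=
    ⟨fun c m n => by rw [hKE, hKF]; exact TensorProduct.smul_tmul (φ c) m n⟩
  haveI : CompatibleSMul K Γ(S, US) Γ(E, U) Γ(F, V) := ⟨fun r m n => by
    have hm : r • m = φ.symm r • m := by rw [hKE, RingEquiv.apply_symm_apply]; rfl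
    have hn : r • n = φ.symm r • n := by rw [hKF, RingEquiv.apply_symm_apply]; rfl
    rw [hm, hn, TensorProduct.smul_tmul]⟩
  let β := TensorProduct.equivOfCompatibleSMul Γ(S, US) K K Γ(E, U) Γ(F, V)
  -- `β : M ⊗_K N ≅ M ⊗_R N`; `e₂ : A ⊗_R N ≅ Q` (flipped square); `eP : C ⊗_A M ≅ P` (degenerate square `Z = Z ×_X X`)
  obtain ⟨e₂, he₂⟩ := exists_linearEquiv_tensor_sections_pullback H.flip hUS hU hV hUle hVle
    (hW.trans (inf_comm _ _)) F hF (hf := rfl) (fun r n => rfl) (fun a s => rfl)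
  obtain ⟨eP, heP⟩ := exists_linearEquiv_tensor_sections_pullback (IsPullback.of_id_snd (f := p)) hU
    hWaff hU hWU le_rfl (inf_eq_right.mpr hWU).symm E hE (hf := rfl)
    (fun r m => by rw [id_appLE_apply]) (fun t s => by rw [id_appLE_apply])
  let c₁ := (AlgebraTensorModule.cancelBaseChange Γ(S, US) Γ(X, U) Γ(X, U) Γ(E, U) Γ(F, V)).symm
  let l₂ := LinearEquiv.lTensor Γ(E, U) e₂
  let c₃ := TensorProduct.comm Γ(X, U) Γ(E, U) Γ(QF, W)
  let c₄ := (AlgebraTensorModule.cancelBaseChange Γ(X, U) Γ(Z, W) Γ(Z, W) Γ(QF, W) Γ(E, U)).symm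
  let l₅ := LinearEquiv.lTensor Γ(QF, W) eP
  let c₆ := TensorProduct.comm Γ(Z, W) Γ(QF, W) Γ(PE, W)
  have h₇ := tensorUnitHom_app_bijective_of_isAffineOpen (hE.pullback p) (hF.pullback q) hWaff
  let t₇ : Γ(PE, W) ⊗[Γ(Z, W)] Γ(QF, W) →+ Γ(boxTensor p q E F, W) :=
    ((tensorUnitHom PE QF).app (op W)).hom.toAddMonoidHom
  have hcomp : ∀ x, boxTensorSectionsHom H.w hUle hVle hW φ hKE hKF hKW x =
      t₇ (c₆ (l₅ (c₄ (c₃ (l₂ (c₁ (β x))))))) := fun x => by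
    induction x using TensorProduct.induction_on with
    | zero => simp only [map_zero]
    | tmul m n =>
      have h2 : e₂ ((1 : Γ(X, U)) ⊗ₜ n) = unitSectionLE q F (le_preimage_right_of_eq_inf hW) n := by
        rw [he₂]; change πp 1 • unitSectionLE q F (le_preimage_right_of_eq_inf hW) n = _; rw [map_one, one_smul]
      have hP : eP ((1 : Γ(Z, W)) ⊗ₜ m) = unitSectionLE p E hWU m := by rw [heP, one_smul]
      change _ = t₇ (c₆ (l₅ (c₄ (c₃ (l₂ (c₁ (m ⊗ₜ n)))))))
      simp only [c₁, l₂, c₃, c₄, l₅, c₆, AlgebraTensorModule.cancelBaseChange_symm_tmul,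
        LinearEquiv.lTensor_tmul, TensorProduct.comm_tmul, h2, hP]
      rfl
    | add x y hx hy => simp only [map_add, hx, hy]
  rw [show ⇑(boxTensorSectionsHom H.w hUle hVle hW φ hKE hKF hKW) = t₇ ∘ c₆ ∘ l₅ ∘ c₄ ∘ c₃ ∘ l₂ ∘ c₁ ∘ β from
    funext hcomp]
  exact h₇.comp (c₆.bijective.comp (l₅.bijective.comp (c₄.bijective.comp
    (c₃.bijective.comp (l₂.bijective.comp (c₁.bijective.comp β.bijective))))))

/-- **`Γ(U ×_{U_S} V, E ⊠ F) ≃ₗ[K] Γ(U, E) ⊗_K Γ(V, F)`** over three affine opens of a cartesian square, for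
affine-localizing (quasi-coherent) `E`, `F`: the inverse of the bijective comparison map (Görtz–Wedhorn I Prop. 4.17
+ Prop. 7.24 (2) + Cor. 7.19 (4), (7.10.2): `Γ(Spec(A ⊗_R B), M~ ⊠ N~) = M ⊗_R N`). For `S = Spec k`, `U_S = ⊤`,
`K = k`, `φ = (ΓSpecIso k)⁻¹` this is `Γ(U ×ₖ V, E ⊠ F) ≃ₗ[k] Γ(U, E) ⊗ₖ Γ(V, F)`.
[cite: GortzWedhorn2020, Cor. 7.19 (4) and Prop. 7.24 (2)] [cite: StacksProject, Tag 01I8] -/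
def boxTensorSectionsEquiv : Γ(boxTensor p q E F, W) ≃ₗ[K] Γ(E, U) ⊗[K] Γ(F, V) :=
  (LinearEquiv.ofBijective (boxTensorSectionsHom H.w hUle hVle hW φ hKE hKF hKW)
    (boxTensorSectionsHom_bijective H hUS hU hV hUle hVle hW hE hF φ hKE hKF hKW)).symm

/-- The inverse of `boxTensorSectionsEquiv` is the comparison map: `e⁻¹(m ⊗ n) = η_p(m)|_W ⊗ η_q(n)|_W`.
[cite: GortzWedhorn2020, Cor. 7.19 (4) and Prop. 7.24 (2)] -/
theorem boxTensorSectionsEquiv_symm_tmul (m : Γ(E, U)) (n : Γ(F, V)) :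
    (boxTensorSectionsEquiv H hUS hU hV hUle hVle hW hE hF φ hKE hKF hKW).symm (m ⊗ₜ n) =
      tmulSection ((Scheme.Modules.pullback p).obj E) ((Scheme.Modules.pullback q).obj F) W
        (unitSectionLE p E (le_preimage_left_of_eq_inf hW) m)
        (unitSectionLE q F (le_preimage_right_of_eq_inf hW) n) :=
  rfl

variable (kU : U' ≤ U) (kV : V' ≤ V) (j : W' ≤ W)
  (ρE : Γ(E, U) →ₗ[K] Γ(E, U')) (hρE : ∀ m, ρE m = E.presheaf.map (homOfLE kU).op m)
  (ρF : Γ(F, V) →ₗ[K] Γ(F, V')) (hρF : ∀ n, ρF n = F.presheaf.map (homOfLE kV).op n)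

include hρE hρF in
/-- **Naturality of the comparison map**: for `U' ⊆ U`, `V' ⊆ V`, `W' = p⁻¹U' ∩ q⁻¹V' ⊆ W` and `K`-linear `ρ_E`,
`ρ_F` computing the restrictions of `E`, `F`: restricting `Γ(W, E ⊠ F) → Γ(W', E ⊠ F)` after the comparison map over
`(U, V)` is the comparison map over `(U', V')` after `ρ_E ⊗ ρ_F` (`(η(m) ⊗ η(n))|_{W'} = η(m|_{U'}) ⊗ η(n|_{V'})`).
[cite: GortzWedhorn2020, Rem. 7.25] -/
theorem boxTensorSectionsHom_natural (x : Γ(E, U) ⊗[K] Γ(F, V)) :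
    (boxTensor p q E F).presheaf.map (homOfLE j).op (boxTensorSectionsHom w hUle hVle hW φ hKE hKF hKW x) =
      boxTensorSectionsHom w hU'le hV'le hW' φ hKE' hKF' hKW' (TensorProduct.map ρE ρF x) := by
  induction x using TensorProduct.induction_on with
  | zero => simp only [map_zero]
  | tmul m n =>
    rw [TensorProduct.map_tmul, boxTensorSectionsHom_tmul, boxTensorSectionsHom_tmul, hρE, hρF,
      unitSectionLE_map_of_le E (le_preimage_left_of_eq_inf hW) (le_preimage_left_of_eq_inf hW') kU j,
      unitSectionLE_map_of_le F (le_preimage_right_of_eq_inf hW) (le_preimage_right_of_eq_inf hW') kV j]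
    exact res_tmulSection _ _ j _ _
  | add x y hx hy => simp only [map_add, hx, hy]

include hρE hρF in
/-- **Naturality of `boxTensorSectionsEquiv`**: `e'(s|_{W'}) = (ρ_E ⊗ ρ_F)(e(s))` — the isomorphisms over the affine
opens `p⁻¹U ∩ q⁻¹V` of `Z` are compatible with restriction (so they assemble over finite affine covers of `X` and `Y`;
the assembly is the consumer's). [cite: GortzWedhorn2020, Rem. 7.25] [cite: StacksProject, Tag 0BEC] -/
theorem boxTensorSectionsEquiv_natural (s : Γ(boxTensor p q E F, W)) :
    boxTensorSectionsEquiv H hUS hU' hV' hU'le hV'le hW' hE hF φ hKE' hKF' hKW'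
        ((boxTensor p q E F).presheaf.map (homOfLE j).op s) =
      TensorProduct.map ρE ρF (boxTensorSectionsEquiv H hUS hU hV hUle hVle hW hE hF φ hKE hKF hKW s) := by
  obtain ⟨y, rfl⟩ : ∃ y, s = (boxTensorSectionsEquiv H hUS hU hV hUle hVle hW hE hF φ hKE hKF hKW).symm y :=
    ⟨_, ((boxTensorSectionsEquiv H hUS hU hV hUle hVle hW hE hF φ hKE hKF hKW).symm_apply_apply s).symm⟩
  rw [LinearEquiv.apply_symm_apply]
  have h := boxTensorSectionsHom_natural H.w hUle hVle hW hU'le hV'le hW' φ hKE hKF hKW hKE' hKF' hKW' kU kV j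
    ρE hρE ρF hρF y
  change boxTensorSectionsEquiv H hUS hU' hV' hU'le hV'le hW' hE hF φ hKE' hKF' hKW'
    ((boxTensor p q E F).presheaf.map (homOfLE j).op (boxTensorSectionsHom H.w hUle hVle hW φ hKE hKF hKW y)) = _
  rw [h]
  exact LinearEquiv.apply_symm_apply _ _

end

end Literature.AlgebraicGeometry.Modules
end
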